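import Literature.Computability.AlgebraicComplexity.BI17FundamentalInvariantForms
import HarnessLib

/-!
# Bürgisser–Ikenmeyer 2017, §3.1: `E(w) = E(D,m)` and `e(w) = e(D,m)` for almost all `w` — discharge

P. Bürgisser, C. Ikenmeyer, *Fundamental invariants of orbit closures*, J. Algebra **477** (2017)
390–434 = arXiv:1511.02927 [BurgisserIkenmeyer2017], §3.1 after Def. 3.6 (`main.tex` L813; held
text `paper:arxiv-1511.02927`, p0008): "It is easy to see that `E(w) = E(D,m)`, and hence
`e(w) = e(D,m)`, for almost all `w ∈ Sym^D ℂ^m`." Theorem-only companion of the file of record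
`BI17FundamentalInvariantForms.lean` (val-lit row BI17-A, t04), which types the sentence as the
named fact `BI2017_degreeMonoid_generic` (Zariski-genericity as `IsZariskiGeneric`).

The (unprinted) argument formalized here: `E(D,m) ⊆ ℕ` is an additive submonoid
(`zero_mem_genericDegreeMonoid`, `add_mem_genericDegreeMonoid`: products of nonzero homogeneous
`SL`-invariants), hence finitely generated — concretely by its least positive element `e₀ = e(D,m)`
together with the least element of each residue class mod `e₀` meeting `E(D,m)` (every positive
`d ∈ E(D,m)` is `m_{d mod e₀} + e₀ q`). Choosing a nonzero homogeneous invariant witness for each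
generator, their product `Z ≠ 0` is the Zariski polynomial: if `Z(w) ≠ 0` then every generator's
witness is nonzero at the point `w = 1 · w` of the orbit `GL · w`, so suitable products of witnesses
show `E(D,m) ⊆ E(w)`; the inclusion `E(w) ⊆ E(D,m)` is the tree's
`degreeMonoid_subset_genericDegreeMonoid`, and `e(w) = e(D,m)` follows by rewriting. Everything
holds over any field and any finite set of variables (`isZariskiGeneric_degreeMonoid_eq`).

* `IsSLInvariantCoord.one/mul/pow` — the `SL`-invariants form a submonoid of `k[Sym^D]`.
* `zero_mem_genericDegreeMonoid`, `add_mem_genericDegreeMonoid`, `mem_degreeMonoid_of_aeval_ne_zero`,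
  `zero_mem_degreeMonoid`.
* `isZariskiGeneric_degreeMonoid_eq` — the generic statement over any field.
* `BI2017_degreeMonoid_generic_holds` — **the fact DISCHARGED**.

No new definitions; no facts introduced. Honest framing: a statement about invariants of generic
forms; nothing here bears on VP versus VNP.

## References

* [BurgisserIkenmeyer2017] P. Bürgisser, C. Ikenmeyer, *Fundamental invariants of orbit closures*,
  J. Algebra 477 (2017) 390–434; arXiv:1511.02927, §3.1 Def. 3.3, Def. 3.6 and the sentence after it.
-/

open MvPolynomial

namespace Literature.Computability.AlgebraicComplexity

section SLInvariantMonoid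

variable {σ k : Type*} [Fintype σ] [DecidableEq σ] [Field k] {D : ℕ}

/-- `1 ∈ O(Sym^D)^{SL}`. [cite: BurgisserIkenmeyer2017, §3 (the invariant ring)] -/
theorem IsSLInvariantCoord.one : IsSLInvariantCoord D (1 : MvPolynomial (DegIdx σ D) k) :=
  fun g => by rw [coordRep_apply, map_one]

/-- `O(Sym^D)^{SL}` is closed under products. [cite: BurgisserIkenmeyer2017, §3 (the invariant ring)] -/
theorem IsSLInvariantCoord.mul {F G : MvPolynomial (DegIdx σ D) k} (hF : IsSLInvariantCoord D F)
    (hG : IsSLInvariantCoord D G) : IsSLInvariantCoord D (F * G) := fun g => by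
  have h1 := hF g
  have h2 := hG g
  rw [coordRep_apply] at h1 h2 ⊢
  rw [map_mul, h1, h2]

/-- `O(Sym^D)^{SL}` is closed under powers. [cite: BurgisserIkenmeyer2017, §3 (the invariant ring)] -/
theorem IsSLInvariantCoord.pow {F : MvPolynomial (DegIdx σ D) k} (hF : IsSLInvariantCoord D F)
    (n : ℕ) : IsSLInvariantCoord D (F ^ n) := fun g => by
  have h1 := hF g
  rw [coordRep_apply] at h1 ⊢
  rw [map_pow, h1]

/-- `0 ∈ E(D,m)`: the constant `1` is a nonzero invariant of degree `0`.
[cite: BurgisserIkenmeyer2017, Def. 3.6] -/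
theorem zero_mem_genericDegreeMonoid : 0 ∈ genericDegreeMonoid σ k D :=
  ⟨1, isHomogeneous_one _ _, IsSLInvariantCoord.one, one_ne_zero⟩

/-- `E(D,m)` is closed under addition (products of nonzero homogeneous invariants), so `E(D,m)` is a
submonoid of `(ℕ,+)` — the "monoid" of Def. 3.6. [cite: BurgisserIkenmeyer2017, Def. 3.6] -/
theorem add_mem_genericDegreeMonoid {d e : ℕ} (hd : d ∈ genericDegreeMonoid σ k D)
    (he : e ∈ genericDegreeMonoid σ k D) : d + e ∈ genericDegreeMonoid σ k D := by
  obtain ⟨F, hFh, hFi, hF0⟩ := hd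
  obtain ⟨G, hGh, hGi, hG0⟩ := he
  exact ⟨F * G, hFh.mul hGh, hFi.mul hGi, mul_ne_zero hF0 hG0⟩

/-- A homogeneous `SL`-invariant of degree `d` that is nonzero AT `w` (the point `1 · w` of the orbit
`GL · w`) does not vanish on the orbit, so `d ∈ E(w)`. [cite: BurgisserIkenmeyer2017, Def. 3.3] -/
theorem mem_degreeMonoid_of_aeval_ne_zero {f : MvPolynomial σ k} {F : MvPolynomial (DegIdx σ D) k}
    {d : ℕ} (hFh : F.IsHomogeneous d) (hFi : IsSLInvariantCoord D F)
    (hF : aeval (formCoeff D f) F ≠ 0) : d ∈ degreeMonoid D f := by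
  refine ⟨F, hFh, hFi, fun h => hF ?_⟩
  have h1 := (mem_orbitVanishingIdeal_iff.mp h) 1
  rwa [map_one, Module.End.one_apply] at h1

/-- `0 ∈ E(w)`: the constant `1` does not vanish on the orbit. [cite: BurgisserIkenmeyer2017, Def. 3.3] -/
theorem zero_mem_degreeMonoid (f : MvPolynomial σ k) : 0 ∈ degreeMonoid D f :=
  mem_degreeMonoid_of_aeval_ne_zero (isHomogeneous_one _ _) IsSLInvariantCoord.one
    (by rw [map_one]; exact one_ne_zero)

/-- The least element of a subclass of a set `S ⊆ ℕ` containing `0` lies in `S` (it is `0` when the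
subclass is empty). [folklore] -/
private theorem sInf_sep_mem {S : Set ℕ} (h0 : 0 ∈ S) (p : ℕ → Prop) :
    sInf {a | a ∈ S ∧ p a} ∈ S := by
  by_cases hne : ({a | a ∈ S ∧ p a} : Set ℕ).Nonempty
  · exact (Nat.sInf_mem hne).1
  · rw [Set.not_nonempty_iff_eq_empty.mp hne, Nat.sInf_empty]
    exact h0

end SLInvariantMonoid

section GenericDegreeMonoid

variable {σ k : Type*} [Fintype σ] [DecidableEq σ] [Field k]

/-- **`E(w) = E(D,m)` and `e(w) = e(D,m)` for Zariski-almost all forms `w` of degree `D`** (BI 2017,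
§3.1 after Def. 3.6, L813: "It is easy to see"), over any field and any finite set of variables.
Proof: `E(D,m)` is generated by `e₀ = e(D,m)` and the least elements `m_r` of the residue classes
mod `e₀` meeting it (every positive `d ∈ E(D,m)` is `m_{d mod e₀} + e₀ q`); the product `Z` of chosen
nonzero homogeneous invariant witnesses of these finitely many generators is nonzero, and `Z(w) ≠ 0`
makes every witness nonzero at `w ∈ GL · w`, whence `E(D,m) ⊆ E(w)` by products of witnesses; the
converse inclusion is `degreeMonoid_subset_genericDegreeMonoid`.
[cite: BurgisserIkenmeyer2017, §3.1 (after Def. 3.6)] -/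
theorem isZariskiGeneric_degreeMonoid_eq (D : ℕ) :
    IsZariskiGeneric D fun f : MvPolynomial σ k =>
      degreeMonoid D f = genericDegreeMonoid σ k D ∧
        minimalDegree D f = genericMinimalDegree σ k D := by
  classical
  set S := genericDegreeMonoid σ k D with hS_def
  have h0S : (0 : ℕ) ∈ S := zero_mem_genericDegreeMonoid
  -- a nonzero homogeneous invariant witness `wit d` for every `d ∈ E(D,m)`
  have H : ∀ d ∈ S, ∃ F : MvPolynomial (DegIdx σ D) k,
      F.IsHomogeneous d ∧ IsSLInvariantCoord D F ∧ F ≠ 0 := fun d h => h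
  choose! wit hwh hwi hw0 using H
  -- generators: the least positive element `e₀` and the least element of each residue class mod `e₀`
  set e₀ := sInf {a | a ∈ S ∧ 0 < a} with he₀_def
  set mrep : ℕ → ℕ := fun r => sInf {a | a ∈ S ∧ a % e₀ = r} with hmrep_def
  have he₀S : e₀ ∈ S := sInf_sep_mem h0S _
  have hmS : ∀ r, mrep r ∈ S := fun r => sInf_sep_mem h0S _
  refine ⟨wit e₀ * ∏ r ∈ Finset.range e₀, wit (mrep r),
    mul_ne_zero (hw0 _ he₀S) (Finset.prod_ne_zero_iff.mpr fun r _ => hw0 _ (hmS r)),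
    fun f _ hZ => ?_⟩
  rw [map_mul, map_prod] at hZ
  have hZ0 : aeval (formCoeff D f) (wit e₀) ≠ 0 := left_ne_zero_of_mul hZ
  have hZr : ∀ r ∈ Finset.range e₀, aeval (formCoeff D f) (wit (mrep r)) ≠ 0 := fun r hr =>
    Finset.prod_ne_zero_iff.mp (right_ne_zero_of_mul hZ) r hr
  have hE : degreeMonoid D f = S := by
    refine Set.Subset.antisymm (degreeMonoid_subset_genericDegreeMonoid D f) fun d hdS => ?_
    rcases Nat.eq_zero_or_pos d with rfl | hd0
    · exact zero_mem_degreeMonoid f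
    · have hpos : ({a | a ∈ S ∧ 0 < a} : Set ℕ).Nonempty := ⟨d, hdS, hd0⟩
      have he₀pos : 0 < e₀ := (Nat.sInf_mem hpos).2
      have hr : d % e₀ ∈ Finset.range e₀ := Finset.mem_range.mpr (Nat.mod_lt d he₀pos)
      have hT : ({a | a ∈ S ∧ a % e₀ = d % e₀} : Set ℕ).Nonempty := ⟨d, hdS, rfl⟩
      have hm_mod : mrep (d % e₀) % e₀ = d % e₀ := (Nat.sInf_mem hT).2
      have hm_le : mrep (d % e₀) ≤ d := Nat.sInf_le ⟨hdS, rfl⟩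
      obtain ⟨q, hq⟩ : e₀ ∣ d - mrep (d % e₀) :=
        Nat.dvd_of_mod_eq_zero (Nat.sub_mod_eq_zero_of_mod_eq hm_mod.symm)
      have hd_eq : d = mrep (d % e₀) + e₀ * q := by omega
      refine mem_degreeMonoid_of_aeval_ne_zero (F := wit (mrep (d % e₀)) * wit e₀ ^ q) ?_
        ((hwi _ (hmS _)).mul ((hwi _ he₀S).pow q)) ?_
      · have hh := (hwh _ (hmS (d % e₀))).mul ((hwh _ he₀S).pow q)
        rwa [← hd_eq] at hh
      · rw [map_mul, map_pow]
        exact mul_ne_zero (hZr _ hr) (pow_ne_zero _ hZ0)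
  refine ⟨hE, ?_⟩
  simp only [minimalDegree, genericMinimalDegree, hE, hS_def]

/-- **BI 2017, "`E(w) = E(D,m)`, and hence `e(w) = e(D,m)`, for almost all `w ∈ Sym^D ℂ^m`"
DISCHARGED** (`isZariskiGeneric_degreeMonoid_eq` at `σ = Fin m`, `k = ℂ`).
[cite: BurgisserIkenmeyer2017, §3.1 (after Def. 3.6)] -/
theorem BI2017_degreeMonoid_generic_holds : BI2017_degreeMonoid_generic := fun D m =>
  isZariskiGeneric_degreeMonoid_eq (σ := Fin m) (k := ℂ) D

end GenericDegreeMonoid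

end Literature.Computability.AlgebraicComplexity
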